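import Summits.BirchSwinnertonDyer.Rank1Residual.O5.ThreeTorsionNormalFormKummer
import Summits.BirchSwinnertonDyer.Rank1Residual.O5.ThreeTorsionNormalFormValuation
import Mathlib.AlgebraicGeometry.EllipticCurve.DivisionPolynomial.Basic
import Mathlib.AlgebraicGeometry.EllipticCurve.VariableChange
import HarnessLib

/-!
# The TANGENT CHANGE at a point of order `3` and Tate's `III` form at `3`: algebra for T29.6 at curve level
# (cell `b2b-bsdres`, team n1011, ROW T-FLEX-KOD extension 2, FILE A — class-free TOOL; seat
#  `b2b-bsdres-n1011-p18` GEN 14 under the idle rule; END file = `O5/FlatKummerImageTypeIIIThreeProofs.lean`)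

HONEST FRAMING (cell `b2b-bsdres`, run/shared/lean/b2b/bsd-rank1-residual/, verbatim in every file): the
goal of the cell is to DELETE the COMBINATION-SHAPED residual classes of the Birch–Swinnerton-Dyer formula
for ALL analytic-rank `≤ 1` elliptic curves over `ℚ` — "full BSD formula for every rank `≤ 1` curve in
class `C`" assembled STRICTLY from published theorems — so that the rank-`≤ 1` remainder becomes exactly
the CONSTRUCTION-SHAPED classes, which are TYPED (missing-input `Prop`s), NOT attempted. This is not
"finishing BSD". Lane CLASS-CLOSURE / O5 (O5 OPEN): research route; census output is EVIDENCE, never a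
Literature fact; nothing is booked; no mark of `RESIDUAL-MAP.md` moves. This file: THEOREMS ONLY (no
definition, no named fact, no `@[conjecture]` node, no `sorry`; net named-fact debt `0`); it proves NOTHING
about any particular curve: ring identities for one change of variables, and `3`-adic bookkeeping on Tate's
normal form of type `III`.

## What is proved

* §1 (any field `K`, `W : WeierstrassCurve K`, `P₀ = (x₀, y₀)`, any `m`): along the change `(u, r, s, t) =
  (1, x₀, m, y₀)` — `a₁' = a₁ + 2m`, `a₃' = 2y₀ + a₁x₀ + a₃` (`smul_a₁_a₃`); `a₆' = 0 ↔ P₀ ∈ W`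
  (`smul_a₆_eq_zero_iff`); `a₄' = 0` when `m` is the tangent slope (`smul_a₄_eq_zero_of_tangent`);
  `b₈' = Ψ₃(x₀)` (`smul_b₈_eq_eval_Ψ₃`); hence (`tangentDen_ne_zero`) **`2y₀ + a₁x₀ + a₃ ≠ 0` at a point of
  order `3` when `Δ ≠ 0`**, and (`smul_tangent_eqs`) the tangent change gives the FLEX FORM
  `y² + a₁'xy + d·y = x³`, `d = 2y₀ + a₁x₀ + a₃` (`a₂' = 0` from `b₈' = a₂'d² = Ψ₃(x₀) = 0`); point transport
  `(x, y) ↦ (x − x₀, y − y₀ − m(x − x₀))` (`equation_smul_iff`) — the second coordinate is LITERALLY o5-r1's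
  `tangentValueAtThree`; `c₄, c₆, Δ` unchanged (`smul_c₄_c₆_Δ`) and on a flex form
  `c₄ = a₁(a₁³ − 24a₃)`, `c₆ = −(a₁⁶ − 36a₁³a₃ + 216a₃²)`, `Δ = a₃³(a₁³ − 27a₃)` (`c₄_c₆_Δ_of_flex`).
* §2 (Tate's form of type `III` over `ℤ₃`: `a₁ = 3α₁, a₂ = 3α₂, a₃ = 3α₃, a₄ = 3α₄, a₆ = 9α₆`, *ATAEC* IV.9.4
  Step 4): `c₄ = 9·(…)` (`IIIForm.c₄_eq`, `‖c₄‖ ≤ 3⁻²`), `c₆ = 27·(−64α₂³ + 24α₂α₄ + 9q)` (`IIIForm.c₆_eq`),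
  `Δ = 27·(−64α₄³ + 3r)` so `‖Δ‖ = 3⁻³` for a unit `α₄` (`IIIForm.norm_Δ`); and the two finite checks
  `zmod9_tate_residue_ne_one : ∀ A B ∈ ℤ/9, B unit → −64A³ + 24AB ≠ 1` and `zmod9_pow_six_eq_one` (`decide`).
* §3 `exists_toZModPow_mul_eq_one` (a norm-one `3`-adic integer is a unit mod `9`), `norm_div_three_le_one`.

References: J. H. Silverman, *AEC* III.1 (change of variables; `Ψ₃` and flexes), *ATAEC* IV.9.4 Step 4
[SilvermanATAEC1994]; o5-r1 GEN 12 `T29-RATIONAL-TORSION-COST-LAW.md` (law T29.6); x11b3-p7 GEN 13/15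
`O5/ThreeTorsionNormalFormValuation.lean` (the reading "Y = tangent value", END-1/END-2).
-/

noncomputable section

open Polynomial WeierstrassCurve

namespace Summit.BirchSwinnertonDyer.Rank1Residual.O5.FlexTangent

/-! ## §1 The tangent change of variables `(1, x₀, m, y₀)` at a point of order `3` (any field) -/

section Algebra

variable {K : Type*} [Field K] (W : WeierstrassCurve K) (x₀ y₀ m : K)

/-- Coefficients `a₁, a₃` of `(1, x₀, m, y₀) • W`. [folklore] -/
theorem smul_a₁_a₃ :
    ((⟨1, x₀, m, y₀⟩ : VariableChange K) • W).a₁ = W.a₁ + 2 * m ∧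
      ((⟨1, x₀, m, y₀⟩ : VariableChange K) • W).a₃ = 2 * y₀ + W.a₁ * x₀ + W.a₃ := by
  refine ⟨?_, ?_⟩
  · rw [variableChange_a₁]; simp
  · rw [variableChange_a₃]; simp; ring

/-- `a₆' = 0` iff `(x₀, y₀)` is on the curve. [folklore] -/
theorem smul_a₆_eq_zero_iff :
    ((⟨1, x₀, m, y₀⟩ : VariableChange K) • W).a₆ = 0 ↔ W.toAffine.Equation x₀ y₀ := by
  rw [Affine.equation_iff, variableChange_a₆]
  simp only [inv_one, Units.val_one, one_pow, one_mul]
  constructor <;> intro h <;> linear_combination -h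

/-- `a₄' = 0` when `m` is the tangent slope: `m · (2y₀ + a₁x₀ + a₃) = 3x₀² + 2a₂x₀ + a₄ − a₁y₀`. [folklore] -/
theorem smul_a₄_eq_zero_of_tangent
    (hm : m * (2 * y₀ + W.a₁ * x₀ + W.a₃) = 3 * x₀ ^ 2 + 2 * W.a₂ * x₀ + W.a₄ - W.a₁ * y₀) :
    ((⟨1, x₀, m, y₀⟩ : VariableChange K) • W).a₄ = 0 := by
  rw [variableChange_a₄]
  simp only [inv_one, Units.val_one, one_pow, one_mul]
  linear_combination -hm

/-- `b₈' = Ψ₃(x₀)` (the constant term of the shifted `3`-division polynomial). [folklore] -/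
theorem smul_b₈_eq_eval_Ψ₃ :
    ((⟨1, x₀, m, y₀⟩ : VariableChange K) • W).b₈ = W.Ψ₃.eval x₀ := by
  rw [variableChange_b₈, WeierstrassCurve.Ψ₃]
  simp only [inv_one, Units.val_one, one_pow, one_mul, eval_add, eval_mul, eval_pow, eval_C, eval_X,
    eval_ofNat]
  ring

/-- On any Weierstrass equation with `a₄ = a₆ = 0`: `b₈ = a₂ a₃²`. [folklore] -/
theorem b₈_eq_of_a₄_a₆ {V : WeierstrassCurve K} (h4 : V.a₄ = 0) (h6 : V.a₆ = 0) :
    V.b₈ = V.a₂ * V.a₃ ^ 2 := by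
  rw [WeierstrassCurve.b₈, h4, h6]; ring

/-- On any Weierstrass equation with `a₃ = a₄ = a₆ = 0`: `Δ = 0`. [folklore] -/
theorem Δ_eq_zero_of_a₃_a₄_a₆ {V : WeierstrassCurve K} (h3 : V.a₃ = 0) (h4 : V.a₄ = 0) (h6 : V.a₆ = 0) :
    V.Δ = 0 := by
  simp only [WeierstrassCurve.Δ, WeierstrassCurve.b₂, WeierstrassCurve.b₄, WeierstrassCurve.b₆,
    WeierstrassCurve.b₈, h3, h4, h6]
  ring

/-- **The tangent denominator does not vanish at a point of order `3`**: if `(x₀, y₀)` is on `W`,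
`Ψ₃(x₀) = 0` and `Δ ≠ 0`, then `2y₀ + a₁x₀ + a₃ ≠ 0` (else the translate has `a₃' = a₆' = 0`,
`b₈' = −a₄'² = Ψ₃(x₀) = 0`, so `a₄' = 0` and `Δ = Δ' = 0`). [folklore] -/
theorem tangentDen_ne_zero (hΔ : W.Δ ≠ 0) (hP : W.toAffine.Equation x₀ y₀) (hΨ : W.Ψ₃.IsRoot x₀) :
    2 * y₀ + W.a₁ * x₀ + W.a₃ ≠ 0 := by
  intro hd
  set V := ((⟨1, x₀, 0, y₀⟩ : VariableChange K) • W) with hV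
  have h3 : V.a₃ = 0 := by rw [(smul_a₁_a₃ W x₀ y₀ 0).2, hd]
  have h6 : V.a₆ = 0 := (smul_a₆_eq_zero_iff W x₀ y₀ 0).2 hP
  have hb : V.b₈ = 0 := by rw [smul_b₈_eq_eval_Ψ₃]; exact hΨ
  have h4 : V.a₄ = 0 := by
    have : V.b₈ = -V.a₄ ^ 2 := by rw [WeierstrassCurve.b₈, h3, h6]; ring
    rw [hb] at this
    exact pow_eq_zero_iff (n := 2) (by norm_num) |>.1 (by linear_combination this)
  have hΔ' : V.Δ = 0 := Δ_eq_zero_of_a₃_a₄_a₆ h3 h4 h6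
  rw [hV, variableChange_Δ] at hΔ'
  simp at hΔ'
  exact hΔ hΔ'

/-- **The flex normal form.** With `d := 2y₀ + a₁x₀ + a₃ ≠ 0` and the tangent slope
`m := (3x₀² + 2a₂x₀ + a₄ − a₁y₀)/d`, the change `(1, x₀, m, y₀)` sends `W` to `y² + a₁'xy + d·y = x³`
(`a₂' = a₄' = a₆' = 0`, `a₃' = d`). [folklore] -/
theorem smul_tangent_eqs (hP : W.toAffine.Equation x₀ y₀) (hΨ : W.Ψ₃.IsRoot x₀)
    (hd : 2 * y₀ + W.a₁ * x₀ + W.a₃ ≠ 0)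
    (hm : m = (3 * x₀ ^ 2 + 2 * W.a₂ * x₀ + W.a₄ - W.a₁ * y₀) / (2 * y₀ + W.a₁ * x₀ + W.a₃)) :
    ((⟨1, x₀, m, y₀⟩ : VariableChange K) • W).a₂ = 0 ∧
      ((⟨1, x₀, m, y₀⟩ : VariableChange K) • W).a₃ = 2 * y₀ + W.a₁ * x₀ + W.a₃ ∧
      ((⟨1, x₀, m, y₀⟩ : VariableChange K) • W).a₄ = 0 ∧
      ((⟨1, x₀, m, y₀⟩ : VariableChange K) • W).a₆ = 0 := by
  have h3 := (smul_a₁_a₃ W x₀ y₀ m).2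
  have h6 : ((⟨1, x₀, m, y₀⟩ : VariableChange K) • W).a₆ = 0 := (smul_a₆_eq_zero_iff W x₀ y₀ m).2 hP
  have h4 : ((⟨1, x₀, m, y₀⟩ : VariableChange K) • W).a₄ = 0 :=
    smul_a₄_eq_zero_of_tangent W x₀ y₀ m (by rw [hm, div_mul_cancel₀ _ hd])
  have hb : ((⟨1, x₀, m, y₀⟩ : VariableChange K) • W).b₈ = 0 := by
    rw [smul_b₈_eq_eval_Ψ₃]; exact hΨ
  rw [b₈_eq_of_a₄_a₆ h4 h6, h3] at hb
  refine ⟨?_, h3, h4, h6⟩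
  rcases mul_eq_zero.1 hb with h | h
  · exact h
  · exact absurd (pow_eq_zero_iff (n := 2) (by norm_num) |>.1 h) hd

/-- Point transport along `(1, x₀, m, y₀)`: `(x, y) ↦ (x − x₀, y − y₀ − m(x − x₀))`. [folklore] -/
theorem equation_smul_iff (x y : K) :
    ((⟨1, x₀, m, y₀⟩ : VariableChange K) • W).toAffine.Equation (x - x₀) (y - y₀ - m * (x - x₀)) ↔
      W.toAffine.Equation x y := by
  rw [Affine.equation_iff, Affine.equation_iff, variableChange_a₁, variableChange_a₂, variableChange_a₃,
    variableChange_a₄, variableChange_a₆]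
  simp only [inv_one, Units.val_one, one_pow, one_mul]
  constructor <;> intro h <;> linear_combination h

/-- Invariants along a change with `u = 1`: `c₄, c₆, Δ` unchanged. [folklore] -/
theorem smul_c₄_c₆_Δ :
    ((⟨1, x₀, m, y₀⟩ : VariableChange K) • W).c₄ = W.c₄ ∧
      ((⟨1, x₀, m, y₀⟩ : VariableChange K) • W).c₆ = W.c₆ ∧
      ((⟨1, x₀, m, y₀⟩ : VariableChange K) • W).Δ = W.Δ := by
  rw [variableChange_c₄, variableChange_c₆, variableChange_Δ]; simp

/-- The invariants of a flex normal form `y² + a₁xy + a₃y = x³` (`a₂ = a₄ = a₆ = 0`):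
`c₄ = a₁(a₁³ − 24a₃)`, `c₆ = −(a₁⁶ − 36a₁³a₃ + 216a₃²)`, `Δ = a₃³(a₁³ − 27a₃)`. [folklore] -/
theorem c₄_c₆_Δ_of_flex {V : WeierstrassCurve K} (h2 : V.a₂ = 0) (h4 : V.a₄ = 0) (h6 : V.a₆ = 0) :
    V.c₄ = V.a₁ * (V.a₁ ^ 3 - 24 * V.a₃) ∧ V.c₆ = -(V.a₁ ^ 6 - 36 * V.a₁ ^ 3 * V.a₃ + 216 * V.a₃ ^ 2) ∧
      V.Δ = V.a₃ ^ 3 * (V.a₁ ^ 3 - 27 * V.a₃) := by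
  simp only [WeierstrassCurve.c₄, WeierstrassCurve.c₆, WeierstrassCurve.Δ, WeierstrassCurve.b₂,
    WeierstrassCurve.b₄, WeierstrassCurve.b₆, WeierstrassCurve.b₈, h2, h4, h6]
  refine ⟨by ring, by ring, by ring⟩

end Algebra

/-! ## §2 Tate's normal form of type `III` over `ℤ₃`: `c₄ ∈ 9ℤ₃`, `27 ∥ Δ`, `c₆ = 27·z` with `z mod 9` off `±1` -/

section TateSide

variable (J : WeierstrassCurve ℤ_[3]) {α₁ α₂ α₃ α₄ α₆ : ℤ_[3]} (ha₁ : J.a₁ = 3 * α₁)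
  (ha₂ : J.a₂ = 3 * α₂) (ha₃ : J.a₃ = 3 * α₃) (ha₄ : J.a₄ = 3 * α₄) (ha₆ : J.a₆ = 9 * α₆)
include ha₁ ha₂ ha₃ ha₄ ha₆

omit ha₆ in
/-- `c₄ = 9 · ((3α₁² + 4α₂)² − 8(2α₄ + 3α₁α₃))` on Tate's `III` form. [folklore] -/
theorem IIIForm.c₄_eq : J.c₄ = 9 * ((3 * α₁ ^ 2 + 4 * α₂) ^ 2 - 8 * (2 * α₄ + 3 * α₁ * α₃)) := by
  simp only [WeierstrassCurve.c₄, WeierstrassCurve.b₂, WeierstrassCurve.b₄, ha₁, ha₂, ha₃, ha₄]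
  ring

/-- `c₆ = 27 · (−64α₂³ + 24α₂α₄ + 9q)` on Tate's `III` form (explicit `q`). [folklore] -/
theorem IIIForm.c₆_eq : J.c₆ = 27 * (-(64 * α₂ ^ 3) + 24 * α₂ * α₄ + 9 *
    (-(3 * α₁ ^ 6 + 12 * α₁ ^ 4 * α₂ + 16 * α₁ ^ 2 * α₂ ^ 2) +
      (8 * α₁ ^ 2 * α₄ + 12 * α₁ ^ 3 * α₃ + 8 * α₂ * α₄ + 16 * α₁ * α₂ * α₃) - 8 * (α₃ ^ 2 + 4 * α₆))) := by
  simp only [WeierstrassCurve.c₆, WeierstrassCurve.b₂, WeierstrassCurve.b₄, WeierstrassCurve.b₆, ha₁, ha₂,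
    ha₃, ha₄, ha₆]
  ring

/-- `Δ = 27 · (−64α₄³ + 3r)` on Tate's `III` form (explicit `r`). [folklore] -/
theorem IIIForm.Δ_eq : J.Δ = 27 * (-(64 * α₄ ^ 3) + 3 *
    (-((3 * α₁ ^ 2 + 4 * α₂) ^ 2 * (9 * α₁ ^ 2 * α₆ + 12 * α₂ * α₆ - 3 * α₁ * α₃ * α₄ + 3 * α₂ * α₃ ^ 2 - α₄ ^ 2))
      - 96 * α₁ * α₃ * α₄ ^ 2 - 144 * α₁ ^ 2 * α₃ ^ 2 * α₄ - 72 * α₁ ^ 3 * α₃ ^ 3 - 27 * (α₃ ^ 2 + 4 * α₆) ^ 2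
      + 9 * (3 * α₁ ^ 2 + 4 * α₂) * (2 * α₄ + 3 * α₁ * α₃) * (α₃ ^ 2 + 4 * α₆))) := by
  simp only [WeierstrassCurve.Δ, WeierstrassCurve.b₂, WeierstrassCurve.b₄, WeierstrassCurve.b₆,
    WeierstrassCurve.b₈, ha₁, ha₂, ha₃, ha₄, ha₆]
  ring

omit ha₁ ha₂ ha₃ ha₄ ha₆ in
/-- `‖−64x³ + 3r‖ = 1` for a unit `x` of `ℤ₃`. [folklore] -/
theorem norm_neg_mul_cube_add_three_mul {x r : ℤ_[3]} (hx : IsUnit x) : ‖-(64 * x ^ 3) + 3 * r‖ = 1 := by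
  have h64 : ‖(64 : ℤ_[3])‖ = 1 := by
    rw [show (64 : ℤ_[3]) = 8 * 8 by norm_num, norm_mul, ThreeTorsionNormalForm.norm_eight, mul_one]
  have hx1 : ‖x‖ = 1 := PadicInt.isUnit_iff.mp hx
  have h1 : ‖-(64 * x ^ 3)‖ = 1 := by rw [norm_neg, norm_mul, norm_pow, h64, hx1]; norm_num
  have h2 : ‖(3 : ℤ_[3]) * r‖ < 1 := by
    rw [norm_mul]
    have h3 : ‖(3 : ℤ_[3])‖ = (3 : ℝ)⁻¹ := by exact_mod_cast PadicInt.norm_p (p := 3)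
    rw [h3]
    have := PadicInt.norm_le_one r
    have h0 := norm_nonneg r
    nlinarith
  rw [PadicInt.norm_add_eq_max_of_ne (by rw [h1]; exact ne_of_gt h2), h1, max_eq_left h2.le]

/-- `‖Δ‖ = 3⁻³` on Tate's `III` form. [folklore] -/
theorem IIIForm.norm_Δ (hα₄ : IsUnit α₄) : ‖J.Δ‖ = (3 : ℝ)⁻¹ ^ 3 := by
  rw [IIIForm.Δ_eq J ha₁ ha₂ ha₃ ha₄ ha₆, norm_mul, norm_neg_mul_cube_add_three_mul hα₄, mul_one,
    show (27 : ℤ_[3]) = 3 ^ 3 by norm_num, norm_pow]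
  congr 1
  exact_mod_cast PadicInt.norm_p (p := 3)

omit ha₆ in
/-- `‖c₄‖ ≤ 3⁻²` on Tate's `III` form. [folklore] -/
theorem IIIForm.norm_c₄_le : ‖J.c₄‖ ≤ (3 : ℝ)⁻¹ ^ 2 := by
  rw [IIIForm.c₄_eq J ha₁ ha₂ ha₃ ha₄, norm_mul, show (9 : ℤ_[3]) = 3 ^ 2 by norm_num, norm_pow]
  have h3 : ‖(3 : ℤ_[3])‖ = (3 : ℝ)⁻¹ := by exact_mod_cast PadicInt.norm_p (p := 3)
  rw [h3]
  exact mul_le_of_le_one_right (by positivity) (PadicInt.norm_le_one _)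

omit ha₁ ha₂ ha₃ ha₄ ha₆ in
/-- The residues: for `A ∈ ℤ/9` and a unit `B ∈ ℤ/9`, `−64A³ + 24AB ≠ 1`. [folklore] -/
theorem zmod9_tate_residue_ne_one : ∀ A B B' : ZMod 9, B * B' = 1 → -(64 * A ^ 3) + 24 * A * B ≠ 1 := by
  decide

omit ha₁ ha₂ ha₃ ha₄ ha₆ in
/-- Units of `ℤ/9` have order dividing `6`. [folklore] -/
theorem zmod9_pow_six_eq_one : ∀ u u' : ZMod 9, u * u' = 1 → u ^ 6 = 1 := by decide

end TateSide

/-! ## §3 Small `3`-adic bookkeeping -/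

section Padic

/-- A unit of `ℤ₃` (as an element of `ℚ₃` of norm `1`) maps to a unit of `ℤ/9`: some `u'` with
`ū · ū' = 1`. [folklore] -/
theorem exists_toZModPow_mul_eq_one {U : ℤ_[3]} (hU : ‖U‖ = 1) :
    ∃ u' : ZMod (3 ^ 2), PadicInt.toZModPow 2 U * u' = 1 := by
  obtain ⟨V, hV⟩ := (PadicInt.isUnit_iff.mpr hU).exists_right_inv
  exact ⟨PadicInt.toZModPow 2 V, by rw [← map_mul, hV, map_one]⟩

/-- `‖x‖ < 1` in `ℚ₃` ⟹ `‖x / 3‖ ≤ 1`. [folklore] -/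
theorem norm_div_three_le_one {x : ℚ_[3]} (hx : ‖x‖ < 1) : ‖x / 3‖ ≤ 1 := by
  rcases ThreeTorsionNormalForm.norm_lt_one_iff.mp hx with h0 | h1
  · rw [h0, zero_div, norm_zero]; exact zero_le_one
  · have hx0 : x ≠ 0 := by
      rintro rfl
      simp at h1
    have h3 : (3 : ℚ_[3]) ≠ 0 := by norm_num
    rw [Padic.norm_le_one_iff_val_nonneg, div_eq_mul_inv, Padic.valuation_mul hx0 (inv_ne_zero h3),
      Padic.valuation_inv]
    have hv3 : (3 : ℚ_[3]).valuation = 1 := by exact_mod_cast Padic.valuation_p (p := 3)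
    rw [hv3]; omega

end Padic

end Summit.BirchSwinnertonDyer.Rank1Residual.O5.FlexTangent
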